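import Summits.BirchSwinnertonDyer.BirchSwinnertonDyer.Theorems.KimAtThreeDeepUpperDefectWitnessOfZetaBody
import Summits.BirchSwinnertonDyer.BirchSwinnertonDyer.Theorems.KimAtThreeDeepUpperOffStratumOfPortFamily
import Summits.BirchSwinnertonDyer.BirchSwinnertonDyer.Theorems.KimAtThreeKolyvaginPortShared
import HarnessLib

/-!
# Route `KimAtThreeKolyvagin` (rung W2), crux `DeepUpperAtThreeOffKatoStratum` (item 19562): the registered
# stub `stub_additiveDefect` VERBATIM — ALL THREE defect disjuncts, `E(ℚ₃)[3] ≠ 0` included — from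
# S24-DEEP ×2 + GZK + Poitou–Tate + crux 19560's residual objects (fine Kato package with exponents, certificate
# supply); NO port hypothesis, NO `ht0`, NO bad-place certificate, NO (C3)

Cell `bsd-addord`, seat `bsd-addord-w2-acc1` gen 2 (PROGRAMME PART 1b, ACCEL-LIST l.753 row (1)), `--supports`
stmt-BirchSwinnertonDyer-19562 (owner w2-c5 assembles via the registered
`Cruxes.DeepUpperAtThreeOffKatoStratum.Birth.DeepUpperAtThreeOffKatoStratum_of`).  Theorems only (no definition,
no named fact, no instance, no `sorry`); nothing is asserted about any curve; the crux stays OPEN; BSD is not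
proved.  Every displayed hypothesis is quantified over the stub's OWN row binders.

## What

* `deepWitnessFamily_of_zetaBody_addv_of_valueRows` — the companion's ★★ deep-keyed witness family on an
  additive row with the per-level VALUE ROWS DISCHARGED by n1011-p02's `ValueRow.valueRow_of_zetaBody` at the
  row's exponent `t` (guards displayed: `hNorm`/`hκ0` — Kato's constant a rational `3`-unit in the coordinate
  of the bound witnesses —, `d′`/`hcd`/`hdd′`, `hAN`, the integer models `aM` of `a_q(P.f)`, END-m1's
  certificates `hE0`/`hE`, `hR0`/`hR`; `9 ∣ N` from `Addv W 3`).
* `portFamilyDeep_of_fineKatoTwoExp_of_certSupply` — gen 1's displayed port family `HPortDefectDeep` (binder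
  of `KimAtThreeDeepUpperAdditiveDefectOfPortEDeep.stub_additiveDefect_of_deepFacts_of_portFamily`: on every
  tower ∧ `Addv` row, at every lattice-optimal datum at the conductor on a defect row, `∃` depth shift and
  exponent with n1011's one-exponent witnesses at every deep-guarded `η`-canonical datum) ⟸ TWO displayed
  inputs of crux 19560's shape on the defect rows: (C1ₜₑ) the FINE KATO PACKAGE WITH EXPONENTS — for SOME
  `t e`, Kato witnesses `(ι, κK, Λ)` of the `ZetaBody` family with `κK` a rational `3`-unit and finite-level
  functionals `Λfin j` carrying the (Λ)-clauses and seat acc6's two-exponent rider clause (ii₂) at `(j, t, e)`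
  (in print `t = log₃ #E(ℚ₃)[3]`, `e = v₃(c₃) + v₃(c_P)`: Kim 2026 Rem. 3.8 read at `3`, the IV/IV* lattice
  `3^{v₃(c₃)−t}ℤ₃·ω_E`, the Manin exponent of `Ω(E) = |c_P|·Ω⁺_f`; r1's LEMMA SAT) — and (C2) the
  CERTIFICATE SUPPLY (kim3's, verbatim on the defect selector).  Depth shift `2`, exponent `t`.
* ★ `stub_additiveDefect_of_deepFacts_of_fineKatoTwoExp_of_certSupply` — the REGISTERED STUB VERBATIM ⟸
  S24-DEEP ×2, GZK, PT, (C1ₜₑ), (C2).  Versus gen 1's ★ (`…_of_deepFacts_of_portTwoExp`: PORT₂ displayed) and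
  seat acc6's 19599 twin (`…_of_fineKato_of_certSupply_of_anomalousRows`: `t = 0` via `ht0`, (C3) displayed):
  no port line, no (C3), and the `E(ℚ₃)[3] ≠ 0` disjunct is COVERED (w2-c3's D6b-u pays the place `3` by the
  deeper family and the bad places by ZetaBody's (C2) conjunct).
* ★ `deepUpperAtThreeOffKatoStratum_of_wuthrich_of_fineKatoTwoExp` — crux 19562 BY NAME ⟸ Wuthrich P21 +
  GZK + hmod + (DD) displayed on the NON-additive rows (w2-c5's stub) + S24-DEEP ×2 + PT + (C1ₜₑ) + (C2).
HONEST LIMITS: (C1ₜₑ) is construction-shaped over the tree (the exp*-shaped riders are axioms on bound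
witnesses, never `_holds`; their model is Kato Thm. 12.5 + Bloch–Kato + SAT), (C2) is open class-wide
(per-row decidable); S24-DEEP ×2 are the route's `S24Deep.*` facts; nothing is booked.
References: [Kato2004Asterisque] (8.1.3), Prop. 8.12, §9.4, Thm. 9.7, Thm. 6.6 (1), Ex. 13.3;
[Kim2022StructureSelmer] Thm. 3.13, Rem. 3.8, §2.2.2, §3.2.3–§3.4.1; [Kim2025RefinedTNC] Thm 1.1, §4.2, §8.1.2;
[MazurRubin2004] Thm. 3.2.4, App. A; [Sakamoto2024] Thm. 4.4; [Wuthrich2014] Prop. 21; [MilneADT2006] I.4.10;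
kim3 memo KIM3-W2-PORT-g10.md; HOME/w2c3/W2C3-D7U-CHAIN-g5.md.
-/

set_option autoImplicit false
-- the Theorems namespace of a single-conjunct summit repeats the summit name by design (D-0017)
set_option linter.dupNamespace false

noncomputable section

open scoped NumberField TensorProduct ContRepresentation Classical
open CategoryTheory Field Function Finset IsDedekindDomain NumberField WeierstrassCurve
open Rat.HeightOneSpectrum
open Literature.NumberTheory.GaloisRepresentations Literature.NumberTheory.GaloisCohomology
open Literature.NumberTheory.GaloisRepresentations.DiscreteGaloisModule
open Literature.NumberTheory.EllipticCurves Literature.NumberTheory.EllipticCurves.ModularForms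
open Literature.NumberTheory.EllipticCurves.Rank1Residual
open Literature.NumberTheory.EllipticCurves.Kato2004
open Literature.NumberTheory.EllipticCurves.Kato2004.EulerSystemValues
open Summit.BirchSwinnertonDyer.Rank1Residual.GaloisImage
open Summit.BirchSwinnertonDyer.BirchSwinnertonDyer.Theses.KimAtThreeKolyvagin
open Summit.BirchSwinnertonDyer.BirchSwinnertonDyer.Theorems.KimAtThreeDeepUpperDefectWitnessOfZetaBody
open Summit.BirchSwinnertonDyer.BirchSwinnertonDyer.Theorems.KimAtThreeDeepUpperAdditiveDefectOfPortEDeep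
open Summit.BirchSwinnertonDyer.BirchSwinnertonDyer.Theorems.KimAtThreeDeepUpperOffStratumOfPortFamily
open Summit.BirchSwinnertonDyer.BirchSwinnertonDyer.Theorems.KimAtThreeDeepUpperOffStratumWuthrich

namespace Summit.BirchSwinnertonDyer.BirchSwinnertonDyer.Theorems.KimAtThreeDeepUpperAdditiveDefectOfFineKato

/-- Local notation: the TWO-EXPONENT rider clause (ii₂) at depth `j`, torsion exponent `t`, defect exponent
`e`, place `v`, for the pair `(Λ, Λf)` — seat acc6's spelling (`KimAtThreeTwoExponentWitnessPair`). -/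
local notation3 (prettyPrint := false) "RIDER₂⟦" W' ", " j ", " t' ", " e' ", " v' ", " Λ' ", " Λf "⟧" =>
  ∀ (r : Finset (HeightOneSpectrum (𝓞 ℚ)))
    (Ψ : H1 (tateRep W' 3) (cycSubgroup 3 0 r) →+
      continuousCohomology 1
        (subgroupRep (WeierstrassCurve.torsionGaloisModule W' (((3 : ℕ) : ℤ) ^ j * ((3 : ℕ) : ℤ))).toTopRep
          (cycSubgroup 3 0 r))),
    (∀ (φ : contOneCocycles (subgroupRep (tateRep W' 3).toTopRep (cycSubgroup 3 0 r)))
        (ψ : contOneCocycles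
          (subgroupRep (WeierstrassCurve.torsionGaloisModule W' (((3 : ℕ) : ℤ) ^ j * ((3 : ℕ) : ℤ))).toTopRep
            (cycSubgroup 3 0 r))),
        (∀ g, ((ψ.1 g : geomTorsion W' (((3 : ℕ) : ℤ) ^ j * ((3 : ℕ) : ℤ))) : geomPoints W') =
          TateModule.proj 3 (j + 1) (φ.1 g)) →
        Ψ (oneCocycleClass _ φ) = oneCocycleClass _ ψ) →
    ∀ (y : H1 (tateRep W' 3) (cycSubgroup 3 0 r))
      (κ₀ : galoisCohomology (WeierstrassCurve.torsionGaloisModule W' (((3 : ℕ) : ℤ) ^ j * ((3 : ℕ) : ℤ))) 1)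
      (s : ℤ_[3]),
      resSubgroup (WeierstrassCurve.torsionGaloisModule W' (((3 : ℕ) : ℤ) ^ j * ((3 : ℕ) : ℤ))).toTopRep
          (cycSubgroup 3 0 r) 1 κ₀ = Ψ y →
      galoisCohomology.localization (WeierstrassCurve.torsionGaloisModule W' (((3 : ℕ) : ℤ) ^ j * ((3 : ℕ) : ℤ)))
          (Sum.inr v') 1 κ₀ ∈ propagatedSelmerStructure W' 3 j (Sum.inr v') →
      (∃ l ∈ cycIntLattice 3 (cycLevel 3 0 r),
          (((3 : ℕ) : ℤ_[3]) ^ t') • Λ' 0 r y - ((s : ℚ_[3]) ⊗ₜ[ℚ] (1 : CyclotomicField (cycLevel 3 0 r) ℚ)) =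
            (((3 : ℕ) : ℤ_[3]) ^ (j + 1)) • (l : ℚ_[3] ⊗[ℚ] CyclotomicField (cycLevel 3 0 r) ℚ)) →
      ((3 ^ e' : ℕ) : ZMod (3 ^ (j + 1))) *
        Λf (galoisCohomology.localization
          (WeierstrassCurve.torsionGaloisModule W' (((3 : ℕ) : ℤ) ^ j * ((3 : ℕ) : ℤ))) (Sum.inr v') 1 κ₀) =
        PadicInt.toZModPow (j + 1) s

/-! ### §1 The deep-keyed witness family with the value rows discharged -/

section Row

variable (W : WeierstrassCurve ℚ) [W.IsElliptic] [W.IsGloballyMinimal]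
  [ContinuousSMul ℤ_[3] (W.tateModule 3)] [Module.Free ℤ_[3] (W.tateModule 3)]
  [Module.Finite ℤ_[3] (W.tateModule 3)]

/-- **★★ The deep-keyed witness family on an additive row, value rows DISCHARGED** — the companion's
`deepWitnessFamily_of_zetaBody_addv` ∘ n1011-p02's `ValueRow.valueRow_of_zetaBody` at exponent `t`
(`hf := P.isNewformOf`, `9 ∣ N` from `Addv W 3`).  Displayed: `hbody`, `hirr`, `Addv W 3`, the functionals with
(Λ)-clauses and (ii₂) riders, `hcdA`, and the level-free VALUE certificates `hNorm`/`hκ0`, `d′`/`hcd`/`hdd′`,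
`hAN`, `aM`/`haM`, `hE0`/`hE`, `hR0`/`hR`.  NO `ht0`, NO bad-place certificate.
[cite: Kato2004Asterisque, (8.1.3) (p. 180), §9.4 (p. 188), Thm. 9.7 (p. 189), Thm. 6.6 (1) (p. 163) and Ex. 13.3 (pp. 224–225)]
[cite: Kim2022StructureSelmer, Thm. 3.13, Rem. 3.8 and §2.2.2] [cite: MazurRubin2004, App. A Prop. A.2 and Thm. 3.2.4] -/
theorem deepWitnessFamily_of_zetaBody_addv_of_valueRows
    {N : ℕ} [NeZero N] (P : ModularParametrizationData W N) (hN : N = W.conductorNorm ℤ)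
    {ι : (n : ℕ) → (CyclotomicField n ℚ →+* ℂ)} {κK : ℝ}
    {Λ : ∀ (k' : ℕ) (r : Finset (HeightOneSpectrum (𝓞 ℚ))),
      H1 (tateRep W 3) (cycSubgroup 3 k' r) →ₗ[ℤ_[3]] ℚ_[3] ⊗[ℚ] CyclotomicField (cycLevel 3 k' r) ℚ}
    {c d a : ℤ} {A : ℕ} [NeZero A]
    {z : ∀ (k' : ℕ) (r : (cyclotomicLevelsRat 3 (badPlaces c d A N)).Ideals),
      H1 (tateRep W 3) ((cyclotomicLevelsRat 3 (badPlaces c d A N)).level k' r.1)}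
    {x : ∀ (k' : ℕ) (r : (cyclotomicLevelsRat 3 (badPlaces c d A N)).Ideals),
      CyclotomicField (cycLevel 3 k' r.1) ℚ}
    (hbody : ZetaBody W 3 P.f ι κK Λ c d a A z x)
    (hirr : W.HasIrreducibleModPGaloisRep 3)
    (hA3 : haveI : Fact (Nat.Prime 3) := ⟨Nat.prime_three⟩; Addv W 3)
    {t e : ℕ} {v₃ : HeightOneSpectrum (𝓞 ℚ)} (hv₃ : ((3 : ℕ) : 𝓞 ℚ) ∈ v₃.asIdeal)
    (Λfin : ∀ j : ℕ, galoisCohomology ((W.torsionGaloisModule (((3 : ℕ) : ℤ) ^ j * ((3 : ℕ) : ℤ))).toLocal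
      (Sum.inr v₃)) 1 →+ ZMod (3 ^ (j + 1)))
    (hΛ : ∀ j : ℕ,
      (∀ c : ZMod (3 ^ (j + 1)), ∃ x ∈ propagatedSelmerStructure W 3 j (Sum.inr v₃), Λfin j x = c) ∧
      (∀ x ∈ propagatedSelmerStructure W 3 j (Sum.inr v₃),
        Λfin j x = 0 ↔ x ∈ W.kummerSelmerStructure (((3 : ℕ) : ℤ) ^ j * ((3 : ℕ) : ℤ)) (Sum.inr v₃)))
    (hfin₂ : ∀ j : ℕ, RIDER₂⟦W, j, t, e, v₃, Λ, Λfin j⟧)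
    {η : (q : HeightOneSpectrum (𝓞 ℚ)) → (ZMod (Ideal.absNorm q.asIdeal))ˣ}
    (hcdA : ∀ q : ℕ, q.Prime → q ≡ 1 [MOD 3] → ¬ q ∣ 2 * c.natAbs * d.natAbs * A)
    -- the VALUE certificates (n1011 T-PK6-VDIS), level-free
    (hNorm : ∃ u : ℚ, (u : ℝ) = κK ∧ padicValRat 3 u = 0) (hκ0 : κK ≠ 0)
    (d' : ℤ) (hcd : Int.gcd (c * d) A = 1) (hdd' : d * d' ≡ 1 [ZMOD (A : ℤ)])
    (hAN : Nat.Coprime A N)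
    (aM : ℕ → ℤ) (haM : ∀ q ∈ (3 * A).primeFactors, cuspCoeff P.f q = aM q)
    (hE0 : ∏ q ∈ (3 * A).primeFactors, (1 - (aM q : ℚ) / q + (if q ∣ N then 0 else (1 / q : ℚ))) ≠ 0)
    (hE : padicValRat 3
      (∏ q ∈ (3 * A).primeFactors, (1 - (aM q : ℚ) / q + (if q ∣ N then 0 else (1 / q : ℚ)))) = 0)
    (hR0 : (c : ℚ) ^ 2 * (d : ℚ) ^ 2 * ratMinusSymbol P.f ((a : ℚ) / A) -
        (c : ℚ) * (d : ℚ) ^ 2 * ratMinusSymbol P.f ((a * c : ℚ) / A) -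
        (c : ℚ) ^ 2 * (d : ℚ) * ratMinusSymbol P.f ((a * d' : ℚ) / A) +
        (c : ℚ) * (d : ℚ) * ratMinusSymbol P.f ((a * c * d' : ℚ) / A) ≠ 0)
    (hR : padicValRat 3 ((c : ℚ) ^ 2 * (d : ℚ) ^ 2 * ratMinusSymbol P.f ((a : ℚ) / A) -
        (c : ℚ) * (d : ℚ) ^ 2 * ratMinusSymbol P.f ((a * c : ℚ) / A) -
        (c : ℚ) ^ 2 * (d : ℚ) * ratMinusSymbol P.f ((a * d' : ℚ) / A) +
        (c : ℚ) * (d : ℚ) * ratMinusSymbol P.f ((a * c * d' : ℚ) / A)) = 0) :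
    ∀ (k : ℕ) (Dk : KolyvaginDatum (W.torsionGaloisModule (((3 : ℕ) : ℤ) ^ k * ((3 : ℕ) : ℤ)))),
      Dk.IsCanonicalTauDatumThreeAtWith W (k + 2) k η →
      ∃ (κ : Finset (HeightOneSpectrum (𝓞 ℚ)) →
            galoisCohomology (W.torsionGaloisModule (((3 : ℕ) : ℤ) ^ k * ((3 : ℕ) : ℤ))) 1)
        (Λ' : galoisCohomology ((W.torsionGaloisModule (((3 : ℕ) : ℤ) ^ k * ((3 : ℕ) : ℤ))).toLocal
            (Sum.inr v₃)) 1 →+ ZMod (3 ^ (k + 1)))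
        (κ' : Finset (HeightOneSpectrum (𝓞 ℚ)) →
            galoisCohomology (W.torsionGaloisModule (((3 : ℕ) : ℤ) ^ k * ((3 : ℕ) : ℤ))) 1),
        KatoKuriharaWitnessAt W k t Dk v₃ P κ Λ' κ' := by
  have hpN : 3 ^ 2 ∣ N := hN ▸ KimAtThreeKolyvaginPortShared.sq_dvd_conductorNorm_of_addv W hA3
  exact deepWitnessFamily_of_zetaBody_addv W P hN hbody hirr hA3 hv₃ Λfin hΛ hfin₂ hcdA
    fun j σ hσI hσχ r hr hKol hη => ValueRow.valueRow_of_zetaBody hbody P.isNewformOf (by decide) hirr hNorm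
      hκ0 d' hcd hdd' hAN hpN aM haM hE0 hE hR0 hR η j t σ hσI hσχ r hr hKol hη

end Row

/-! ### §2 The defect rows of 19562: gen 1's port family from (C1ₜₑ) + (C2) -/

section Defect

variable
  -- (C1ₜₑ) FINE KATO PACKAGE WITH EXPONENTS on the additive-defect rows (crux 19560's (C1) with the rider
  -- clause (ii) ↦ (ii₂) at the row's torsion exponent `t` and ONE defect exponent `e`)
  (hC1 : ∀ (W : WeierstrassCurve ℚ) [W.IsElliptic] [W.IsGloballyMinimal]
    [ContinuousSMul ℤ_[3] (W.tateModule 3)] [Module.Free ℤ_[3] (W.tateModule 3)]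
    [Module.Finite ℤ_[3] (W.tateModule 3)],
    (∀ m : ℕ, W.HasSurjectiveModNGaloisRep (3 ^ m : ℕ)) →
    (haveI : Fact (Nat.Prime 3) := ⟨Nat.prime_three⟩; Addv W 3) →
    ∀ (v₃ : HeightOneSpectrum (𝓞 ℚ)), ((3 : ℕ) : 𝓞 ℚ) ∈ v₃.asIdeal →
    ∀ {N : ℕ} [NeZero N] (P : ModularParametrizationData W N), N = W.conductorNorm ℤ →
      (∀ z ∈ P.L.lattice, ∃ w ∈ periodLattice P.f, z = P.c * w) →
      (3 ∣ (W.baseChange ℚ_[3]).localTamagawaNumber ℤ_[3] ∨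
        Nat.card {Q : (W.baseChange ℚ_[3]).toAffine.Point // (3 : ℕ) • Q = 0} ≠ 1 ∨
        (3 : ℤ) ∣ P.maninConstant) →
      ∃ (t e : ℕ) (ι : (n : ℕ) → (CyclotomicField n ℚ →+* ℂ)) (κK : ℝ)
        (Λ : ∀ (k' : ℕ) (r : Finset (HeightOneSpectrum (𝓞 ℚ))),
          H1 (tateRep W 3) (cycSubgroup 3 k' r) →ₗ[ℤ_[3]] ℚ_[3] ⊗[ℚ] CyclotomicField (cycLevel 3 k' r) ℚ)
        (Λfin : ∀ j : ℕ, galoisCohomology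
          ((W.torsionGaloisModule (((3 : ℕ) : ℤ) ^ j * ((3 : ℕ) : ℤ))).toLocal (Sum.inr v₃)) 1 →+
            ZMod (3 ^ (j + 1))),
        κK ≠ 0 ∧ (∃ u : ℚ, (u : ℝ) = κK ∧ padicValRat 3 u = 0) ∧
        (∀ j : ℕ,
          (∀ c : ZMod (3 ^ (j + 1)), ∃ x ∈ propagatedSelmerStructure W 3 j (Sum.inr v₃), Λfin j x = c) ∧
          (∀ x ∈ propagatedSelmerStructure W 3 j (Sum.inr v₃),
            Λfin j x = 0 ↔ x ∈ W.kummerSelmerStructure (((3 : ℕ) : ℤ) ^ j * ((3 : ℕ) : ℤ)) (Sum.inr v₃))) ∧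
        (∀ j : ℕ, RIDER₂⟦W, j, t, e, v₃, Λ, Λfin j⟧) ∧
        ∀ (c d a : ℤ) (A : ℕ), 0 < A → Int.gcd c (6 * 3 * A) = 1 → Int.gcd d (6 * 3 * N) = 1 →
          ∃ (z : ∀ (k' : ℕ) (r : (cyclotomicLevelsRat 3 (badPlaces c d A N)).Ideals),
                H1 (tateRep W 3) ((cyclotomicLevelsRat 3 (badPlaces c d A N)).level k' r.1))
            (x : ∀ (k' : ℕ) (r : (cyclotomicLevelsRat 3 (badPlaces c d A N)).Ideals),
                CyclotomicField (cycLevel 3 k' r.1) ℚ),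
            ZetaBody W 3 P.f ι κK Λ c d a A z x)
  -- (C2) CERTIFICATE SUPPLY on the additive-defect rows (kim3's (C2), verbatim on the defect selector)
  (hC2 : ∀ (W : WeierstrassCurve ℚ) [W.IsElliptic] [W.IsGloballyMinimal],
    (∀ m : ℕ, W.HasSurjectiveModNGaloisRep (3 ^ m : ℕ)) →
    (haveI : Fact (Nat.Prime 3) := ⟨Nat.prime_three⟩; Addv W 3) →
    ∀ {N : ℕ} [NeZero N] (P : ModularParametrizationData W N), N = W.conductorNorm ℤ →
      (∀ z ∈ P.L.lattice, ∃ w ∈ periodLattice P.f, z = P.c * w) →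
      (3 ∣ (W.baseChange ℚ_[3]).localTamagawaNumber ℤ_[3] ∨
        Nat.card {Q : (W.baseChange ℚ_[3]).toAffine.Point // (3 : ℕ) • Q = 0} ≠ 1 ∨
        (3 : ℤ) ∣ P.maninConstant) →
      ∃ (c d a : ℤ) (A : ℕ) (d' : ℤ) (aM : ℕ → ℤ),
        0 < A ∧ Int.gcd c (6 * 3 * A) = 1 ∧ Int.gcd d (6 * 3 * N) = 1 ∧
        (∀ q : ℕ, q.Prime → q ≡ 1 [MOD 3] → ¬ q ∣ 2 * c.natAbs * d.natAbs * A) ∧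
        Int.gcd (c * d) A = 1 ∧ d * d' ≡ 1 [ZMOD (A : ℤ)] ∧ Nat.Coprime A N ∧
        (∀ q ∈ (3 * A).primeFactors, cuspCoeff P.f q = aM q) ∧
        (∏ q ∈ (3 * A).primeFactors,
            (1 - (aM q : ℚ) / q + (if q ∣ N then 0 else (1 / q : ℚ))) ≠ 0) ∧
        padicValRat 3 (∏ q ∈ (3 * A).primeFactors,
            (1 - (aM q : ℚ) / q + (if q ∣ N then 0 else (1 / q : ℚ)))) = 0 ∧
        ((c : ℚ) ^ 2 * (d : ℚ) ^ 2 * ratMinusSymbol P.f ((a : ℚ) / A) -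
            (c : ℚ) * (d : ℚ) ^ 2 * ratMinusSymbol P.f ((a * c : ℚ) / A) -
            (c : ℚ) ^ 2 * (d : ℚ) * ratMinusSymbol P.f ((a * d' : ℚ) / A) +
            (c : ℚ) * (d : ℚ) * ratMinusSymbol P.f ((a * c * d' : ℚ) / A) ≠ 0) ∧
        padicValRat 3 ((c : ℚ) ^ 2 * (d : ℚ) ^ 2 * ratMinusSymbol P.f ((a : ℚ) / A) -
            (c : ℚ) * (d : ℚ) ^ 2 * ratMinusSymbol P.f ((a * c : ℚ) / A) -
            (c : ℚ) ^ 2 * (d : ℚ) * ratMinusSymbol P.f ((a * d' : ℚ) / A) +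
            (c : ℚ) * (d : ℚ) * ratMinusSymbol P.f ((a * c * d' : ℚ) / A)) = 0)

include hC1 hC2

/-- **Gen 1's displayed port family `HPortDefectDeep` on the additive-defect rows of 19562, from (C1ₜₑ) +
(C2)** — per row: the certificate supply gives Kato's auxiliary datum `(c, d, a, A)` with unit value
certificates, the fine package gives `(t, e, ι, κK, Λ, Λfin)` and `ZetaBody` for that datum; then §1 with depth
shift `2` and exponent `t` (instance binders of the Tate module discharged by the tree's `_holds` theorems,
`E[3]` irreducible under the tower).  The row binders `η`/`hη` of the family are honoured through the
With-guard of each datum.  Closes nothing; (C1ₜₑ)/(C2) stay displayed.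
[cite: Kato2004Asterisque, (8.1.3) (p. 180), §9.4 (p. 188), Thm. 9.7 (p. 189) and Ex. 13.3 (pp. 224–225)]
[cite: Kim2022StructureSelmer, Thm. 3.13, Rem. 3.8 and §2.2.2] [cite: MazurRubin2004, App. A Prop. A.2] -/
theorem portFamilyDeep_of_fineKatoTwoExp_of_certSupply :
    ∀ (W : WeierstrassCurve ℚ) [W.IsElliptic] [W.IsGloballyMinimal],
      (∀ m : ℕ, W.HasSurjectiveModNGaloisRep (3 ^ m : ℕ)) →
      (haveI : Fact (Nat.Prime 3) := ⟨Nat.prime_three⟩; Addv W 3) →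
      ∀ (v₃ : HeightOneSpectrum (𝓞 ℚ)), ((3 : ℕ) : 𝓞 ℚ) ∈ v₃.asIdeal →
      ∀ (η : (q : HeightOneSpectrum (𝓞 ℚ)) → (ZMod (Ideal.absNorm q.asIdeal))ˣ),
        (∀ q, Subgroup.zpowers (η q) = ⊤) →
      ∀ {N : ℕ} [NeZero N] (P : ModularParametrizationData W N), N = W.conductorNorm ℤ →
        (∀ z ∈ P.L.lattice, ∃ w ∈ periodLattice P.f, z = P.c * w) →
        (3 ∣ (W.baseChange ℚ_[3]).localTamagawaNumber ℤ_[3] ∨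
          Nat.card {Q : (W.baseChange ℚ_[3]).toAffine.Point // (3 : ℕ) • Q = 0} ≠ 1 ∨
          (3 : ℤ) ∣ P.maninConstant) →
        ∃ t e : ℕ, ∀ (k : ℕ)
          (Dk : KolyvaginDatum (W.torsionGaloisModule (((3 : ℕ) : ℤ) ^ k * ((3 : ℕ) : ℤ)))),
          Dk.IsCanonicalTauDatumThreeAtWith W (k + t) k η →
          ∃ (κ : Finset (HeightOneSpectrum (𝓞 ℚ)) →
                galoisCohomology (W.torsionGaloisModule (((3 : ℕ) : ℤ) ^ k * ((3 : ℕ) : ℤ))) 1)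
            (Λ : galoisCohomology ((W.torsionGaloisModule (((3 : ℕ) : ℤ) ^ k * ((3 : ℕ) : ℤ))).toLocal
                (Sum.inr v₃)) 1 →+ ZMod (3 ^ (k + 1)))
            (κ' : Finset (HeightOneSpectrum (𝓞 ℚ)) →
                galoisCohomology (W.torsionGaloisModule (((3 : ℕ) : ℤ) ^ k * ((3 : ℕ) : ℤ))) 1),
            KatoKuriharaWitnessAt W k e Dk v₃ P κ Λ κ' := by
  intro W _ _ htow hA v₃ hv₃ η _hη N _ P hN hlat hdef
  haveI : Fact (Nat.Prime 3) := ⟨Nat.prime_three⟩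
  haveI : ContinuousSMul ℤ_[3] (W.tateModule 3) := TateModule.continuousSMul_padicInt
  haveI : Module.Free ℤ_[3] (W.tateModule 3) := W.module_free_tateModule_holds 3
  haveI : Module.Finite ℤ_[3] (W.tateModule 3) := W.module_finite_tateModule_holds 3
  obtain ⟨c, d, a, A, d', aM, hApos, hcA, hdN, hcdA, hcd, hdd', hAN, haM, hE0, hE, hR0, hR⟩ :=
    hC2 W htow hA P hN hlat hdef
  haveI : NeZero A := ⟨hApos.ne'⟩
  obtain ⟨t, e, ι, κK, Λ, Λfin, hκ0, hNorm, hΛ, hfin₂, hz⟩ := hC1 W htow hA v₃ hv₃ P hN hlat hdef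
  obtain ⟨z, x, hbody⟩ := hz c d a A hApos hcA hdN
  have hirr : W.HasIrreducibleModPGaloisRep 3 :=
    KimAtThreeKolyvaginPortShared.hasIrreducibleModPGaloisRep_three_of_tower W htow
  exact ⟨2, t, deepWitnessFamily_of_zetaBody_addv_of_valueRows W P hN hbody hirr hA hv₃ Λfin hΛ hfin₂ hcdA
    hNorm hκ0 d' hcd hdd' hAN aM haM hE0 hE hR0 hR⟩

/-- ★ **The registered stub `stub_additiveDefect` of crux 19562 VERBATIM — all three defect disjuncts — from
S24-DEEP ×2, GZK, Poitou–Tate, (C1ₜₑ) and (C2)**: gen 1's ★ `stub_additiveDefect_of_deepFacts_of_portFamily`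
fed `portFamilyDeep_of_fineKatoTwoExp_of_certSupply`.  NO port hypothesis, NO `ht0`, NO bad-place certificate,
NO (C3), NO (DD), NO (U′), NO Manin / period / `c₃` hypothesis: the additive-defect rows of 19562 carry EXACTLY
crux 19560's residual objects (fine Kato package — here with the exponents `(t, e)` —, certificate supply).
The owner's assembly reads `DeepUpperAtThreeOffKatoStratum_of stub_nonAdditive (this hS24d hS24d₂ hGZK hPT hC1 hC2)`.
[cite: Kim2025RefinedTNC, Thm 1.1] [cite: Kim2022StructureSelmer, Thm. 3.13, Rem. 3.8 and §2.2.2]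
[cite: Sakamoto2024, Thm. 4.4 (1)(2) (p. 926)] [cite: MilneADT2006, Ch. I, Thm. 4.10]
[cite: Kato2004Asterisque, (8.1.3), §9.4, Thm. 9.7 and Ex. 13.3] -/
theorem stub_additiveDefect_of_deepFacts_of_fineKatoTwoExp_of_certSupply
    (hS24d : S24Deep.kolyvaginSystems_freeRankOne_zmod_three_pow_deep)
    (hS24d₂ : S24Deep.kolyvaginSystems_idealOfBasis_eq_fittingIdeal_zmod_three_pow_deep)
    (hGZK : rank_eq_analyticRank_of_analyticRank_le_one)
    (hPT : poitouTate_selmerStructure_duality ℚ) :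
    ∀ (W₀ : WeierstrassCurve ℚ) [W₀.IsElliptic] [W₀.IsGloballyMinimal],
      (∀ n : ℕ, W₀.HasSurjectiveModNGaloisRep (3 ^ n : ℕ)) → Finite W₀.sha →
      ∀ {N : ℕ} [NeZero N], N = W₀.conductorNorm ℤ →
      ∀ (D₀ : Literature.NumberTheory.EllipticCurves.ModularForms.ModularParametrizationData W₀ N),
        (∀ z ∈ D₀.L.lattice, ∃ w ∈ Literature.NumberTheory.EllipticCurves.ModularForms.periodLattice D₀.f, z = D₀.c * w) →
        (∀ (W₂ : WeierstrassCurve ℚ) [W₂.IsElliptic]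
          (D₂ : Literature.NumberTheory.EllipticCurves.ModularForms.ModularParametrizationData W₂ N),
          D₂.f = D₀.f → D₀.modularDegree ≤ D₂.modularDegree) →
        (∀ r : ℚ, Literature.NumberTheory.EllipticCurves.ratPlusSymbol D₀.f r ≠ 0 →
          0 ≤ padicValRat 3 (Literature.NumberTheory.EllipticCurves.ratPlusSymbol D₀.f r)) →
        Literature.NumberTheory.EllipticCurves.kuriharaVanishingOrder W₀ 3 D₀.f = 0 →
        (haveI : Fact (Nat.Prime 3) := ⟨Nat.prime_three⟩;
            Literature.NumberTheory.EllipticCurves.Rank1Residual.Addv W₀ 3) →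
        (3 ∣ (W₀.baseChange ℚ_[3]).localTamagawaNumber ℤ_[3] ∨
          Nat.card {Q : (W₀.baseChange ℚ_[3]).toAffine.Point // (3 : ℕ) • Q = 0} ≠ 1 ∨
          (3 : ℤ) ∣ D₀.maninConstant) →
        ∃ d : ℕ, Literature.NumberTheory.EllipticCurves.kuriharaPartialDeepInfty W₀ 3 D₀.f = d ∧
          ((padicValNat 3 (Nat.card (AddCommGroup.primaryComponent W₀.sha 3)) + d : ℕ) : ℕ∞) ≤
            Literature.NumberTheory.EllipticCurves.kuriharaPartial W₀ 3 D₀.f 0 :=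
  stub_additiveDefect_of_deepFacts_of_portFamily hS24d hS24d₂ hGZK hPT
    (portFamilyDeep_of_fineKatoTwoExp_of_certSupply hC1 hC2)

/-- ★ **Crux `DeepUpperAtThreeOffKatoStratum` (19562) BY NAME** ⟸ Wuthrich 2014 Prop. 21, GZK, modularity,
(DD) displayed on the NON-additive rows only (w2-c5's `stub_nonAdditive_of_wuthrich_of_deepInfty_le_tamagawa`),
S24-DEEP ×2, Poitou–Tate, (C1ₜₑ), (C2) — gen 1's `deepUpperAtThreeOffKatoStratum_of_wuthrich_of_deepPortFamily`
with its port family produced by `portFamilyDeep_of_fineKatoTwoExp_of_certSupply`.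
[cite: Wuthrich2014, Prop. 21 (p. 399)] [cite: Kim2025RefinedTNC, Thm 1.1]
[cite: Kim2022StructureSelmer, Thm. 3.13, Rem. 3.8, Conj. 1.10 (PDF p. 8)] [cite: Sakamoto2024, Thm. 4.4 (1)(2) (p. 926)] -/
theorem deepUpperAtThreeOffKatoStratum_of_wuthrich_of_fineKatoTwoExp
    (hW : Wuthrich2014.sha_dvd_analyticSha)
    (hGZK : rank_eq_analyticRank_of_analyticRank_le_one) (hmod : hasEntireLFunction_rat)
    (hDD : ∀ (W₀ : WeierstrassCurve ℚ) [W₀.IsElliptic] [W₀.IsGloballyMinimal],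
      (∀ n : ℕ, W₀.HasSurjectiveModNGaloisRep (3 ^ n : ℕ)) → Finite W₀.sha →
      ∀ {N : ℕ} [NeZero N], N = W₀.conductorNorm ℤ →
      ∀ (D₀ : ModularParametrizationData W₀ N),
        (∀ z ∈ D₀.L.lattice, ∃ w ∈ periodLattice D₀.f, z = D₀.c * w) →
        (∀ (W₂ : WeierstrassCurve ℚ) [W₂.IsElliptic] (D₂ : ModularParametrizationData W₂ N),
          D₂.f = D₀.f → D₀.modularDegree ≤ D₂.modularDegree) →
        (∀ r : ℚ, ratPlusSymbol D₀.f r ≠ 0 → 0 ≤ padicValRat 3 (ratPlusSymbol D₀.f r)) →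
        kuriharaVanishingOrder W₀ 3 D₀.f = 0 →
        ¬ (haveI : Fact (Nat.Prime 3) := ⟨Nat.prime_three⟩; Addv W₀ 3) →
        kuriharaPartialDeepInfty W₀ 3 D₀.f ≤ ((padicValNat 3 W₀.tamagawaProduct : ℕ) : ℕ∞))
    (hS24d : S24Deep.kolyvaginSystems_freeRankOne_zmod_three_pow_deep)
    (hS24d₂ : S24Deep.kolyvaginSystems_idealOfBasis_eq_fittingIdeal_zmod_three_pow_deep)
    (hPT : poitouTate_selmerStructure_duality ℚ) :
    DeepUpperAtThreeOffKatoStratum :=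
  deepUpperAtThreeOffKatoStratum_of_wuthrich_of_deepPortFamily hW hGZK hmod hDD hS24d hS24d₂ hPT
    (portFamilyDeep_of_fineKatoTwoExp_of_certSupply hC1 hC2)

end Defect

end Summit.BirchSwinnertonDyer.BirchSwinnertonDyer.Theorems.KimAtThreeDeepUpperAdditiveDefectOfFineKato

end
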